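import Mathlib
import HarnessLib
import Literature.Probability.Percolation.DiscontinuityGammaTwo
import Summits.CriticalPhenomena.PercolationContinuityZ3.Theorems.PercNecklaceBackboneTruncatedSusceptibilityFiniteOfThetaOfCritical

/-!
# The crux `TruncatedSusceptibilityFiniteOfTheta` (stmt-CriticalPhenomena-0852) under `θ(p_c) = 0` and under `γ < 2`

Crux L of `PercolationContinuityZ3` (routes `PercNecklaceBackbone` r4, `PercTruncatedSusceptibility` r3,
`PercAntiMeanFieldOnset` r3): `∀ p, θ_{ℤ³}(p) > 0 → Σ_x P_p(0 ↔ x, |C(0)| < ∞) < ∞`. By the landed reduction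
`TruncatedSusceptibilityFiniteOfTheta_iff_critical` the crux is equivalent to its single instance at `p_c`,
and it is implied by the registered open stub `stub_criticalRadiusMoment` of the lead's line
(`Cruxes/TruncatedSusceptibilityFiniteOfTheta/Lines/birth.lean`):
`θ(p_c) > 0 ⇒ Σ_n (n+1)² · P_{p_c}(0 ↔ ∂B(n), |C(0)| < ∞) < ∞`.

This file records, as kernel-checked wiring, the two NAMED hypotheses under which that stub (hence the crux)
closes VACUOUSLY — i.e. the hypotheses that kill the jump world `θ(p_c) > 0` itself:

* `stub_criticalRadiusMoment_of_percolationContinuity` — `θ(p_c) = 0` (the conjunct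
  `Literature.Probability.Percolation.PercolationContinuityZ3`) makes the stub's hypothesis absurd;
* `stub_criticalRadiusMoment_of_sq_mul_expClusterSize_small` — **`γ < 2` in the weakest (liminf) sense**,
  `liminf_{p ↑ p_c} (p_c - p)² · E_p|C| = 0`, spelled exactly as the hypothesis of the tree theorem
  `theta_criticalProb_eq_zero_of_sq_mul_expClusterSize_small` (`DiscontinuityGammaTwo.lean`: Newman 1986's
  "a jump at `p_c` forces `γ ≥ 2`", proved there from Hutchcroft 2022 Thm 1.3), gives `θ(p_c) = 0` and hence
  the stub;

together with the corresponding closures of the crux in its three route spellings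
(`TruncatedSusceptibilityFiniteOfTheta_of_sq_mul_expClusterSize_small`, `…'`, `…''`, and
`TruncatedSusceptibilityFiniteOfTheta_of_percolationContinuity`). Numerically `γ(3) ≈ 1.8 < 2`, so the
second hypothesis is believed true; it is the relative-entropy route (T3) of the line's STUB-2 analysis
(`Lines/birth-STUB2-analysis.md`), which is the ONLY perturbative comparison `p_c - ε → p_c` whose price is
not provably `≥ c·θ(p_c)` in a jump world. No new definitions; no named-fact hypothesis (the `γ < 2`
hypothesis is an explicit quantitative assumption, not a `def … : Prop`).
-/

noncomputable section

namespace Summit.CriticalPhenomena.PercolationContinuityZ3.Theorems.TruncatedSusceptibilityFiniteOfTheta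

open MeasureTheory Literature.Probability.Percolation Literature.Probability.LatticeModels

/-- **STUB 2 under `θ(p_c) = 0`.** If `PercolationContinuityZ3` holds (the real world), the registered stub
`stub_criticalRadiusMoment` of crux stmt-CriticalPhenomena-0852 holds vacuously: its hypothesis
`0 < θ(p_c)` is absurd. (Recorded to make the vacuity explicit: the stub has content only in the jump
world.) -/
theorem stub_criticalRadiusMoment_of_percolationContinuity
    (hcont : Literature.Probability.Percolation.PercolationContinuityZ3) :
    0 < theta (zdGraph 3) (0 : Site 3) (criticalProbI 3) →
      Summable fun n : ℕ => ((n : ℝ) + 1) ^ 2 *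
        (bondPercolation (zdGraph 3) (criticalProbI 3)).real (siteToBoundary 3 n \ percolatesAt 0) := by
  intro hθ
  have h0 : theta (zdGraph 3) (0 : Site 3) (criticalProbI 3) = 0 := hcont
  exact absurd h0 hθ.ne'

/-- **STUB 2 under `γ < 2` (liminf form).** If `(p_c - p)² · E_p|C(0)|` becomes arbitrarily small along
parameters `p ∈ [p_c/2, p_c)` of bond percolation on `ℤ³` — i.e. `liminf_{p ↑ p_c} (p_c - p)² χ(p) = 0`,
true whenever `χ(p) ≤ A (p_c - p)^{-γ}` near `p_c` with `γ < 2` — then `θ(p_c) = 0`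
(`theta_criticalProb_eq_zero_of_sq_mul_expClusterSize_small`, Newman 1986 / Hutchcroft 2022), so the
registered stub `stub_criticalRadiusMoment` holds (vacuously). -/
theorem stub_criticalRadiusMoment_of_sq_mul_expClusterSize_small : (∀ η : ℝ, 0 < η → ∃ p : unitInterval, criticalProb (zdGraph 3) 0 / 2 ≤ (p : ℝ) ∧ (p : ℝ) < criticalProb (zdGraph 3) 0 ∧ ENNReal.ofReal ((criticalProb (zdGraph 3) 0 - p) ^ 2) * expClusterSize (zdGraph 3) 0 p ≤ ENNReal.ofReal η) → 0 < theta (zdGraph 3) (0 : Site 3) (criticalProbI 3) → Summable fun n : ℕ => ((n : ℝ) + 1) ^ 2 * (bondPercolation (zdGraph 3) (criticalProbI 3)).real (siteToBoundary 3 n \ percolatesAt 0) :=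
  fun h => stub_criticalRadiusMoment_of_percolationContinuity
    (theta_criticalProb_eq_zero_of_sq_mul_expClusterSize_small (d := 3) (by norm_num) h)

/-- **The crux under `θ(p_c) = 0`** (vacuous live case + the landed supercritical regime):
`PercolationContinuityZ3 → TruncatedSusceptibilityFiniteOfTheta` (PercNecklaceBackbone spelling). -/
theorem TruncatedSusceptibilityFiniteOfTheta_of_percolationContinuity
    (hcont : Literature.Probability.Percolation.PercolationContinuityZ3) :
    Summit.CriticalPhenomena.PercolationContinuityZ3.Theses.PercNecklaceBackbone.TruncatedSusceptibilityFiniteOfTheta :=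
  TruncatedSusceptibilityFiniteOfTheta_of_criticalRadiusMoment
    (stub_criticalRadiusMoment_of_percolationContinuity hcont)

/-- **The crux under `γ < 2` (liminf form)**: `liminf_{p ↑ p_c} (p_c - p)² E_p|C| = 0` on `ℤ³` implies
`TruncatedSusceptibilityFiniteOfTheta` (PercNecklaceBackbone spelling) — through `θ(p_c) = 0`
(`DiscontinuityGammaTwo.lean`) at `p = p_c` and the landed supercritical regime at `p > p_c`. -/
theorem TruncatedSusceptibilityFiniteOfTheta_of_sq_mul_expClusterSize_small
    (h : ∀ η : ℝ, 0 < η → ∃ p : unitInterval,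
      criticalProb (zdGraph 3) 0 / 2 ≤ (p : ℝ) ∧ (p : ℝ) < criticalProb (zdGraph 3) 0 ∧
        ENNReal.ofReal ((criticalProb (zdGraph 3) 0 - p) ^ 2) * expClusterSize (zdGraph 3) 0 p ≤
          ENNReal.ofReal η) :
    Summit.CriticalPhenomena.PercolationContinuityZ3.Theses.PercNecklaceBackbone.TruncatedSusceptibilityFiniteOfTheta :=
  TruncatedSusceptibilityFiniteOfTheta_of_criticalRadiusMoment
    (stub_criticalRadiusMoment_of_sq_mul_expClusterSize_small h)

/-- The same closure for the home-route spelling (`PercTruncatedSusceptibility`, r3). -/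
theorem TruncatedSusceptibilityFiniteOfTheta_of_sq_mul_expClusterSize_small'
    (h : ∀ η : ℝ, 0 < η → ∃ p : unitInterval,
      criticalProb (zdGraph 3) 0 / 2 ≤ (p : ℝ) ∧ (p : ℝ) < criticalProb (zdGraph 3) 0 ∧
        ENNReal.ofReal ((criticalProb (zdGraph 3) 0 - p) ^ 2) * expClusterSize (zdGraph 3) 0 p ≤
          ENNReal.ofReal η) :
    Summit.CriticalPhenomena.PercolationContinuityZ3.Theses.PercTruncatedSusceptibility.TruncatedSusceptibilityFiniteOfTheta :=
  TruncatedSusceptibilityFiniteOfTheta_of_sq_mul_expClusterSize_small h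

/-- The same closure for the `PercAntiMeanFieldOnset` spelling (r3). -/
theorem TruncatedSusceptibilityFiniteOfTheta_of_sq_mul_expClusterSize_small''
    (h : ∀ η : ℝ, 0 < η → ∃ p : unitInterval,
      criticalProb (zdGraph 3) 0 / 2 ≤ (p : ℝ) ∧ (p : ℝ) < criticalProb (zdGraph 3) 0 ∧
        ENNReal.ofReal ((criticalProb (zdGraph 3) 0 - p) ^ 2) * expClusterSize (zdGraph 3) 0 p ≤
          ENNReal.ofReal η) :
    Summit.CriticalPhenomena.PercolationContinuityZ3.Theses.PercAntiMeanFieldOnset.TruncatedSusceptibilityFiniteOfTheta :=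
  TruncatedSusceptibilityFiniteOfTheta_of_sq_mul_expClusterSize_small h

end Summit.CriticalPhenomena.PercolationContinuityZ3.Theorems.TruncatedSusceptibilityFiniteOfTheta

end
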